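import Literature.MathematicalPhysics.QuantumManyBody.BoseGasThermodynamicLimitRuelle
import HarnessLib

/-!
# Route `BECRieszReverseHolder` — crux `MicroscaleFlatness`, stub `stub_groundStateEnergy_linear`

Supports (does not close) stmt-AtomisticToContinuum-12842; stub `stub_groundStateEnergy_linear`
of the birth line of crux MicroscaleFlatness, route BECRieszReverseHolder.

Statement: for a repulsive finite-range pair potential `v` there is `ρ₀ > 0` such that for every
density `0 < ρ < ρ₀` there is a constant `E > 0` with `E₀(n+1, L_{n+1}) ≤ E · (n+1)` for all
large `n`, where `L_N = (N/ρ)^{1/3}` is the fixed-density box side (linear Ruelle upper bound on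
the Dirichlet ground-state energy along the thermodynamic sequence).

Proof: with `R > 0` a range of `v` (`IsRepulsiveFiniteRange.exists_pos_range`) take
`ρ₀ = 1/(2(1+R)³)`; then `ρ(1+R)³ < 1`, so the tree's Ruelle programme
(`limsup_lt_top_of_small`, [Ruelle1969, §3.5.11]) gives `ℓ := limsup_N E₀(N, L_N)/N < ∞`.
With `E := ℓ.toReal + 1` we have `ℓ < ofReal E`, hence eventually `E₀(N, L_N)/N < ofReal E`
(`Filter.eventually_lt_of_limsup_lt`); shifting to `N = n + 1` (`Filter.tendsto_add_atTop_nat`)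
and clearing the (finite, nonzero) denominator (`ENNReal.div_lt_iff`) gives the claim.
-/

namespace Summit.AtomisticToContinuum.BoseEinsteinCondensation.Theorems.MicroscaleFlatness

open Filter
open scoped ENNReal
open Literature.MathematicalPhysics.QuantumManyBody.BoseGas

/-- **Stub `stub_groundStateEnergy_linear`** (birth line of crux `MicroscaleFlatness`): for a
repulsive finite-range `v` with range `R`, every density `0 < ρ < 1/(2(1+R)³)` admits `E > 0` with
`E₀(n+1, ((n+1)/ρ)^{1/3}) ≤ E (n+1)` for all large `n`.
[cite: Ruelle1969, §3.5.11] via `limsup_lt_top_of_small`. -/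
theorem stub_groundStateEnergy_linear :
    ∀ v : ℝ → ENNReal, Literature.MathematicalPhysics.QuantumManyBody.BoseGas.IsRepulsiveFiniteRange v →
      ∃ ρ₀ : ℝ, 0 < ρ₀ ∧ ∀ ρ : ℝ, 0 < ρ → ρ < ρ₀ → ∃ E : ℝ, 0 < E ∧ ∀ᶠ n : ℕ in Filter.atTop,
        Literature.MathematicalPhysics.QuantumManyBody.BoseGas.groundStateEnergy v (n + 1)
            (Literature.MathematicalPhysics.QuantumManyBody.BoseGas.sideLength ρ (n + 1)) ≤
          ENNReal.ofReal E * ((n + 1 : ℕ) : ENNReal) := by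
  intro v hv
  obtain ⟨R, hR, hv0⟩ := hv.exists_pos_range
  have h3 : (0 : ℝ) < (1 + R) ^ 3 := by positivity
  refine ⟨1 / (2 * (1 + R) ^ 3), by positivity, fun ρ hρ hρlt => ?_⟩
  have hsmall : ρ * (1 + R) ^ 3 < 1 := by
    calc ρ * (1 + R) ^ 3 < 1 / (2 * (1 + R) ^ 3) * (1 + R) ^ 3 :=
          mul_lt_mul_of_pos_right hρlt h3
      _ = 1 / 2 := by field_simp
      _ < 1 := by norm_num
  have hlim : limsup (energyPerParticleDirichlet v ρ) atTop < ⊤ :=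
    limsup_lt_top_of_small hv.1 hv0 hR hρ hsmall
  set ℓ : ℝ≥0∞ := limsup (energyPerParticleDirichlet v ρ) atTop
  refine ⟨ℓ.toReal + 1, by positivity, ?_⟩
  have hE : ℓ < ENNReal.ofReal (ℓ.toReal + 1) := by
    calc ℓ = ENNReal.ofReal ℓ.toReal := (ENNReal.ofReal_toReal hlim.ne).symm
      _ < ENNReal.ofReal (ℓ.toReal + 1) :=
          (ENNReal.ofReal_lt_ofReal_iff (by positivity)).2 (lt_add_one _)
  have hev : ∀ᶠ N : ℕ in atTop, energyPerParticleDirichlet v ρ N < ENNReal.ofReal (ℓ.toReal + 1) :=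
    Filter.eventually_lt_of_limsup_lt hE
  have hev' : ∀ᶠ n : ℕ in atTop,
      energyPerParticleDirichlet v ρ (n + 1) < ENNReal.ofReal (ℓ.toReal + 1) :=
    (tendsto_add_atTop_nat 1).eventually hev
  filter_upwards [hev'] with n hn
  unfold energyPerParticleDirichlet at hn
  have h0 : ((n + 1 : ℕ) : ℝ≥0∞) ≠ 0 := by exact_mod_cast Nat.succ_ne_zero n
  have htop : ((n + 1 : ℕ) : ℝ≥0∞) ≠ ⊤ := ENNReal.natCast_ne_top _
  exact ((ENNReal.div_lt_iff (Or.inl h0) (Or.inl htop)).1 hn).le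

end Summit.AtomisticToContinuum.BoseEinsteinCondensation.Theorems.MicroscaleFlatness
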